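/-
Origin: expansion seat `planner-pub-hodgecm-mc-axioms-1-g14-0`, handover #W181 2026-08-20T15:53:55Z md5 be950d4430c6 (PKG 9cc0377ca2da → be950d4430c6; 129 l.; MECHANICAL (iib-R) rewrite v3.1 of the PKG file as it stands (15 token edits; rules R1x1+RX[h₂']x14)) (`HOME/mc/pub-hodgecm-mc-axioms-1-g14/revendor/kit-r55/stage55/HodgeCM/Model/Sanity/ArchKTypeSanity.lean`, md5 be950d4430c6, 129 lines);
landed by the gen-22 packager (p-g22) in gate run 55 REPLACES the earlier landed copy of `HodgeCM/Model/Sanity/ArchKTypeSanity.lean` (seat copy carried the packager Origin header of an earlier run (stripped)).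
-/
/-
Origin: SANITY lane `planner-pub-hodgecm-mc-sanity-1-g5-0` (unit pub-hodgecm-mc-sanity-1-g5, gen 5 of mc-sanity-1,
node SAN-10b), 2026-08-19.  v2 RE-CUT for the coordinated RUN-34 «level-free ιinf + arch × fin splitting» revision of
`HodgeCM.Model.ThetaSpaceInputPin` (mc-theta-3-g3 v2 candidate 5a6bf8038289) and `HodgeCM.Model.ThetaSpaceInputPinRigidity`
(v2 candidate 308a82655361): SUPERSEDES the RUN-33 bytes b686628be185 (gen 4) of this same path — whole-file replacement,
same 7 declaration names; delta = the hypotheses `hι` of § 1 lose their `Level` binder (`∀ u : Stab(x₀), Sv.ιinf u = 1`,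
`Sv.ιinf = 1`).  Imports SAN-10a v2 `HodgeCM.Model.Sanity.ThetaAdelicSideDegenerate` (this seat) and theta-3's v2 #9;
nothing imports it.  Install AFTER both.  KERNEL: 0 records, 0 hypotheses minted, no global instances, nothing cited.
Expected `#print axioms`: ⊆ {propext, Classical.choice, Quot.sound}.
-/
import Summits.HodgeConjecture.HodgeCM.Model.Sanity.ThetaAdelicSideDegenerate
import Summits.HodgeConjecture.HodgeCM.Model.ThetaSpaceInputPinRigidity

/-!
# SAN-10b: E's binder `C` (R9) is EMPTY over every archimedean-trivial adelic side `S`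

The junction of SAN-10a with mc-theta-3-g3's rigidity theorems — the INSTRUMENT OF RECORD for the rigidity of the
socket over the pin is theta-3's `Model/ArchKTypeRigidity` (#8: `ArchKTypeData.exists_omega_apply_ne`) and
`Model/ThetaSpaceInputPinRigidity` (#9: `weightOf_x₀_eq_zero_of_forall_eq`, `thetaSpaceInputIn_tau_rigid`,
`exists_omega_apply_ne_in`, `omega_ne_one_in`, `isEmpty_archKTypeData_in/off/pin` under `hω : (P k).ω = 1`); this
file only adds what they leave out.  R9 (`Model/E2InstanceR9`) asks, fibrewise over the regime
`hV : IsAnisotropic L V.Hm` (and a good context of degree 6), for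

  `C … k hk N hN : Model.ArchKTypeData (thetaSpaceInputIn hHD hI h₁ h₂ h₃ (S V c) hV) k N`   (`k ∈ {0,1}`, `0 < N`).

* § 1 **Archimedean component trivial on the stabiliser ⇒ empty socket, whatever `ω` is.**  If
  `Sv.ιinf u = 1` for all `u ∈ Stab_{U(2,1)}(x₀)` (e.g. `Sv.ιinf = 1`; v2: `ιinf` is level-free), then
  `ArchKTypeData (thetaSpaceInputIn … Sv hV) k N` is empty for `N ≠ 0` (`isEmpty_archKTypeData_of_ιinf_apply_eq_one`,
  `…_of_ιinf_eq_one`) — the second degenerate direction of `S`, not covered by `hω : ω = 1`.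
* § 2 **Over the degenerate sides of SAN-10a** (`degThetaAdelicSide V c Φ_∞ x₀ hx₀`, `degS V c`; there `ω = 1` AND
  `ιinf = 1`) the socket is empty over the regime input (`isEmpty_archKTypeData_deg`, `isEmpty_archKTypeData_degS`),
  over the pin `thetaSpaceInputOf … degS V c` in BOTH branches (`isEmpty_archKTypeData_pin_degS`), and the fibre of
  E's binder `C` at any ONE regime context is empty: even the sub-binder
  `∀ k, k = 0 ∨ k = 1 → ∀ N, 0 < N → ArchKTypeData (thetaSpaceInputIn … (degS V c) hV) k N` (R9's `C V c hV hc h6`)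
  has no inhabitant (`isEmpty_C_fibre_degS`), so a full `C` over `S := degS` refutes every guard it is fed
  (`C_over_degS_refutes_guards`).

VERDICT for the carvers / BINDER-TRIAGE (MODEL-N += 0, no new binder): the pair (`S`, `C`) of R9 is NOT jointly
cheap.  `S` alone is free data (SAN-10a), but any inhabitant of `C` certifies that `S`'s Weil action composed with
`S.ιinf` moves a member of the supplied family under `Stab(x₀)` (theta-3 #9 `exists_omega_apply_ne_in`) — so
neither `ω := 1` nor `ιinf|Stab(x₀) := 1` survives: the (W2)/(W3) content sits exactly at the junction
`S.P.ω ∘ S.ιinf` ↔ `C.prodN`/`C.harm` (+ `C.arch₀`, `P.hx₀`).  (`hol` has content only relative to an inhabited `C`,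
so it inherits this.)  NOT claimed: anything about `C` over the honest `S` — theta-3's open node.
-/

set_option autoImplicit false

noncomputable section

open MulAction NumberField NumberField.mixedEmbedding
open Literature.Geometry.ComplexHyperbolic.BallModel (U21 Ball x₀)
open Literature.NumberTheory.Automorphic Literature.NumberTheory.Weil1964
open Literature.AlgebraicGeometry.HodgeTheory Literature.AlgebraicGeometry.ShimuraVarieties
open Literature.NumberTheory.Automorphic.PicardCM
open HodgeCM.Model.SupplyInstance HodgeCM.Model.SupplyResidual
open scoped SchwartzMap Classical

namespace HodgeCM
namespace Model
namespace Sanity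

variable (hHD : exists_isReal_hodgeModel) (hI : hodgePQ_independent_of_hodgeModel)
  (h₁ : BallQuotientUniformised)  (h₃ : CMAbelianVarietyRealised)

variable {L : CMField} {ι₁ : L →+* ℂ} {V : HermSpace3 L ι₁} {c : SeesawCtx L}

/-! ## § 1. Archimedean component trivial on the stabiliser ⇒ empty socket (any `ω`) -/

/-- **Archimedean component trivial on the stabiliser ⇒ no archimedean `K`-type data**: if
`Sv.ιinf u = 1` for all `u ∈ Stab_{U(2,1)}(x₀)`, then whatever the pair action `ω` is,
`ArchKTypeData (thetaSpaceInputIn … Sv hV) k N` is empty for `N ≠ 0`. -/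
theorem isEmpty_archKTypeData_of_ιinf_apply_eq_one (Sv : ThetaAdelicSide V c) (hV : IsAnisotropic L V.Hm)
    (k : Fin 4) {N : ℕ} (hN : N ≠ 0) (hι : ∀ u : stabilizer U21 x₀, Sv.ιinf u = 1) :
    IsEmpty (ArchKTypeData (thetaSpaceInputIn hHD hI h₁ h₃ Sv hV) k N) :=
  ⟨fun C => by
    obtain ⟨u, ℓ, h⟩ := exists_omega_apply_ne_in hHD hI h₁ h₃ C hN
    exact h (by rw [hι u, ← Prod.one_eq_mk, map_one, Module.End.one_apply])⟩

/-- The case `Sv.ιinf = 1` (archimedean component trivial). -/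
theorem isEmpty_archKTypeData_of_ιinf_eq_one (Sv : ThetaAdelicSide V c) (hV : IsAnisotropic L V.Hm)
    (k : Fin 4) {N : ℕ} (hN : N ≠ 0) (hι : Sv.ιinf = 1) :
    IsEmpty (ArchKTypeData (thetaSpaceInputIn hHD hI h₁ h₃ Sv hV) k N) :=
  isEmpty_archKTypeData_of_ιinf_apply_eq_one hHD hI h₁ h₃ Sv hV k hN fun u => by
    rw [hι, MonoidHom.one_apply]

/-! ## § 2. Over the degenerate sides of SAN-10a the fibres of E's binder `C` are empty -/

/-- Over `degThetaAdelicSide V c Φ_∞ x₀ hx₀` (any test function): no `C` at any level `N ≠ 0`. -/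
theorem isEmpty_archKTypeData_deg (Φinf : 𝓢((Fin 3 → mixedSpace (maximalRealSubfield L)), ℂ))
    (x : Fin 3 → maximalRealSubfield L) (hx : Φinf (archEmb (maximalRealSubfield L) (Fin 3) x) ≠ 0)
    (hV : IsAnisotropic L V.Hm) (k : Fin 4) {N : ℕ} (hN : N ≠ 0) :
    IsEmpty (ArchKTypeData (thetaSpaceInputIn hHD hI h₁ h₃ (degThetaAdelicSide V c Φinf x hx) hV) k N) :=
  isEmpty_archKTypeData_in hHD hI h₁ h₃ _ hV rfl hN

/-- Over the literal binder inhabitant `degS`, regime input: no `C` at any level `N ≠ 0`. -/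
theorem isEmpty_archKTypeData_degS (V : HermSpace3 L ι₁) (c : SeesawCtx L) (hV : IsAnisotropic L V.Hm)
    (k : Fin 4) {N : ℕ} (hN : N ≠ 0) :
    IsEmpty (ArchKTypeData (thetaSpaceInputIn hHD hI h₁ h₃ (degS V c) hV) k N) :=
  isEmpty_archKTypeData_in hHD hI h₁ h₃ _ hV rfl hN

/-- Over the PIN `X := thetaSpaceInputOf … degS V c` of R9 (both branches of the `dite`): no `C` at any `N ≠ 0`. -/
theorem isEmpty_archKTypeData_pin_degS (V : HermSpace3 L ι₁) (c : SeesawCtx L) (k : Fin 4) {N : ℕ} (hN : N ≠ 0) :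
    IsEmpty (ArchKTypeData (thetaSpaceInputOf hHD hI h₁ h₃ degS V c) k N) :=
  isEmpty_archKTypeData_pin hHD hI h₁ h₃ degS rfl hN

/-- **The fibre of E's binder `C` over `degS` at one regime context is empty**: even the sub-binder
`∀ k, k = 0 ∨ k = 1 → ∀ N, 0 < N → ArchKTypeData (thetaSpaceInputIn … (degS V c) hV) k N` (R9's `C V c hV hc h6`)
has no inhabitant — instantiate at `k := 0`, `N := 1`. -/
theorem isEmpty_C_fibre_degS (V : HermSpace3 L ι₁) (c : SeesawCtx L) (hV : IsAnisotropic L V.Hm) :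
    IsEmpty (∀ k : Fin 4, k = 0 ∨ k = 1 → ∀ N : ℕ, 0 < N →
      ArchKTypeData (thetaSpaceInputIn hHD hI h₁ h₃ (degS V c) hV) k N) :=
  ⟨fun C => (isEmpty_archKTypeData_degS hHD hI h₁ h₃ V c hV 0 one_ne_zero).false (C 0 (Or.inl rfl) 1 one_pos)⟩

/-- Hence a FULL inhabitant of R9's binder `C` over `S := degS` refutes every regime context it is fed: any function
producing the sub-binder at `(V, c, hV)` from premises `Q` (R9: `Q` = good context ∧ degree 6) shows `¬ Q`. -/
theorem C_over_degS_refutes_guards {Q : Prop} (V : HermSpace3 L ι₁) (c : SeesawCtx L) (hV : IsAnisotropic L V.Hm)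
    (C : Q → ∀ k : Fin 4, k = 0 ∨ k = 1 → ∀ N : ℕ, 0 < N →
      ArchKTypeData (thetaSpaceInputIn hHD hI h₁ h₃ (degS V c) hV) k N) : ¬ Q :=
  fun q => (isEmpty_C_fibre_degS hHD hI h₁ h₃ V c hV).false (C q)

end Sanity
end Model
end HodgeCM

end
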